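import Summits.AtomisticToContinuum.BoseEinsteinCondensation.Theorems.BECThomsonPrincipleFibreConductanceConditionalDefs
import Summits.AtomisticToContinuum.BoseEinsteinCondensation.Theorems.BECThomsonPrincipleFibreConductanceDualForm
import HarnessLib

/-!
# Route `BECThomsonPrinciple`, crux `FibreConductance` (stmt-AtomisticToContinuum-9480),
# line `conditional-law-poincare` — bridge to the crux's dual form (`…FibreConductanceDualForm`)

The line's vocabulary file `…FibreConductanceConditionalDefs` keeps its own copy `cruxCharge` of the
crux's charge and its own dual-form statement `CruxDualBound` (so as not to depend on
`…FibreConductanceDualForm`, whose farm build lagged when the line was set up). This file records that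
they ARE the objects of the dual-form file, definitionally: `cruxCharge = fibreCharge` (`rfl`),
`CruxDualBound ↔ FibreDualBound` (`Iff.rfl`), hence `FibreConductance ↔ CruxDualBound`
(`fibreConductance_iff_dual`). [folklore]
-/

noncomputable section

namespace Summit.AtomisticToContinuum.BoseEinsteinCondensation.Cruxes.FibreConductance.ConditionalLawPoincare

open Summit.AtomisticToContinuum.BoseEinsteinCondensation.Theses.BECThomsonPrinciple (FibreConductance)
open Summit.AtomisticToContinuum.BoseEinsteinCondensation.Cruxes.FibreConductance.HealingSplitKineticDefect

variable {m : ℕ} {L : ℝ}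

/-- The line's charge is the dual-form file's charge. [folklore] -/
theorem cruxCharge_eq_fibreCharge (n : Fin 3 → ℤ) (Φ : Literature.MathematicalPhysics.QuantumManyBody.BoseGas.PeriodicTrialState (m + 1) L) :
    cruxCharge n Φ = fibreCharge n Φ := rfl

/-- The line's dual-form statement is the dual-form file's. [folklore] -/
theorem cruxDualBound_iff_fibreDualBound : CruxDualBound ↔ FibreDualBound := Iff.rfl

/-- **The crux is the line's dual-form statement**: `FibreConductance ↔ CruxDualBound` (Thomson
duality, `fibreConductance_iff_dual`). [folklore] -/
theorem fibreConductance_iff_cruxDualBound : FibreConductance ↔ CruxDualBound :=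
  fibreConductance_iff_dual.trans cruxDualBound_iff_fibreDualBound.symm

end Summit.AtomisticToContinuum.BoseEinsteinCondensation.Cruxes.FibreConductance.ConditionalLawPoincare

end
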